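import Literature.MathematicalPhysics.QuantumFieldTheory.Balaban1983to89.B15Prop1Thm1GeneralFormShapes
import Literature.Computability.QuantumComplexity.SU2ChordGeometry

/-!
# `Balaban1983to89.B15Prop1JointHolomorphyFromBackground` — [Balaban1989LargeFieldI] Prop. 1 p. 194 (last clause) ∕ [Balaban1989LargeFieldII] p. 358
# («the integral extended analytically on Gᶜ-valued configurations U … The expressions in the integral are analytic functions of U») and p. 359
# («The above equations, bounds and statements are valid for 𝔤ᶜ-valued fields, hence the existence of the analytic extension follows immediately»):
# THE JOINT-HOLOMORPHY LETTER (J1) OF THE N12∕s1 ENDPOINT DERIVED FROM A CONFIGURATION-LEVEL LETTER (J0ᵛ) — the Wilson action of an `SU(2)` field is a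
# trace polynomial in the complex matrix entries, so the ACTION `A(U_{k,Z}(·))` of (1.77) inherits a bounded holomorphic extension from one of the
# BACKGROUND CONFIGURATION `U_{k,Z}(·)` of (1.74) ([Balaban1985Variational] Prop. 9 p. 309: «The minimal configuration U_k(V) … has an extension to an
# analytic function of Gᶜ-valued small configurations V′»).

Honest framing: statement-level skeleton of published theorems with citation tags; proofs where landed; nothing here is a claim about the Yang–Mills mass gap.

Cell pub-ymgap, HUMAN RULINGS D-0062 ∕ D-0149, seat `pub-ymgap-dag-n12-c` (R134 (a), s1 of node N12 = [B15]; g16).  PDFs held: `paper:balaban1989-cmp122-large-field-i`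
(p. 194), `…-large-field-ii` (pp. 358–359 = PDF 4–5, re-read first-hand for this module).

WHY.  After `B15Prop1Thm1GeneralFormShapes` (p556967) the N12∕s1 endpoint (Proposition 1 [IV] INHABITED at print's (1.74) object) displays, per instance, two
analytic letters about print's function (1.77) `f = fun177std bg M₁ Z k = wilsonAction4 ∘ bgKZstd bg M₁ Z k`: (J1) `hGj`, ONE jointly holomorphic bounded extension
of `(p, B′) ↦ A(U_{k,Z}(exp(iB′)·ext(exp(ip)V_k)))`, and (L2) `hlead`.  Print's source of (J1) is a statement about the CONFIGURATION, not the action: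
[Balaban1985Variational] Prop. 9 p. 309 (the minimal configuration is analytic in the complexified datum), composed with [Balaban1988Convergent] (2.14) and the
chart; [Balaban1989LargeFieldII] p. 358 then says «The expressions in the integral are analytic functions of U» — for the Wilson action the elementary fact that
`A(U) = Σ_p (1 − ½ tr U(∂p))` is a polynomial in the matrix entries once `U(b)⁻¹` is read as the adjugate (`SU(2)`: `U† = adj U`, `tr U ∈ ℝ`).  THIS MODULE TYPES
THAT FACT AND THE COMPOSITION: (J1) follows from the configuration-level letter
(J0ᵛ) `hBg` — «along the chart family `(p, B′) ↦ exp(iB′)·ext(exp(ip)V_k)` there is ONE family `Ũ` on the sup-ball of radius `R` of pairs of `𝔤ᶜ`-valued bond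
  fields, bondwise in `M₂(ℂ)`, with ℂ-differentiable entries bounded by `𝓐₀`, which at every REAL point IS some `SU(2)` configuration carrying the VALUE (1.77)»,
with the explicit action bound `𝓐 = |Plaq| · (1 + 8𝓐₀⁴)`.  VALUE-MATCHED, not selector-pinned (seat n12-w1's LOCATED-SELECTOR, pub-ymgap INBOX 2026-08-27T22:47Z):
at the record `bgKZstd` runs through `UminOfRecord`, a `Classical.choose` selection from the (2.12) minimal set, so a letter pinning `Ũ` to ITS values would be
uninhabitable; (J0ᵛ) is inhabited by ANY holomorphic family of minimisers — print's (190) — because (1.77) is the value function (every minimiser of the datum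
has the value `fun177std … V`; that one-line junction is n12-w1's lane).  The located residual of (J1) is thus print's Prop. 9 at NODE 00's objects.

WHAT THIS FILE PROVES (no `sorry`, no definition, no `… : Prop` fact; axioms standard).
§1 `SU(2)`-valued gauge fields as complex matrices ([Balaban1987RG1] (0.2), `UnitaryModel`: `reTr = Re Tr ∕ 2`; the `SU(2)` facts `U† = adj U`, `Im tr U = 0` are
   CITED from `Literature.Computability.QuantumComplexity.SU2ChordGeometry`): `reTr_eq_trace_re`, `ofReal_one_sub_reTr`, `coe_plaqHol`, ★ `ofReal_wilsonAction4` —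
   `(A(U) : ℂ) = Σ_p (1 − tr(U₁U₂·adj U₃·adj U₄)∕2)`, the trace-polynomial reading of the Wilson action (the object of [LF-II] p. 358's «integral extended
   analytically on Gᶜ-valued configurations», stated without a definition); private plumbing `coe_inv_eq_adjugate`.
§2 Holomorphy and bound of that trace polynomial along ANY matrix-field family with ℂ-differentiable bounded entries (generic normed domain `E`):
   `differentiableOn_actionSum`, `norm_actionSum_le` (`≤ |Plaq|·(1 + 8𝓐₀⁴)`); private `2 × 2` entry calculus (`adjugate_apply_fin_two`, `differentiableOn_mul_apply`,
   `differentiableOn_adjugate_apply`, `differentiableOn_plaqProd_apply`, `norm_mul_apply_le`, `norm_adjugate_apply_le`, `norm_plaqProd_apply_le`, `norm_one_sub_trace_div_two_le`).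
§3 ★ `jointHolomorphic_fun177std_of_valueMatched` — (J1) ⇐ (J0ᵛ) at one datum (any `DetBackground`, any instance data), `𝓐 := |Plaq P 0|·(1 + 8𝓐₀⁴)`.
§4 ★★★ `exists_domain_prop1Printed_lfVarOn_std_su2_box_intrinsic_analytic_atZSeqCoPRecord_ofThm1TorusClass_ofValueMatched` — p556967 §4's endpoint
   `…_ofThm1TorusClass` VERBATIM but for: (J1) `hGj` REPLACED by (J0ᵛ) `hBg`, `h𝓐` dropped, and `𝓐 i := |Plaq (F.P Kt) 0|·(1 + 8(𝓐₀ i)⁴)` in `hcJ'` and in the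
   clause's radius.  Every other binder ((L2) `hlead`+`hsm`∕`hγle`, `hfar`, (Gᵃ) `hZblk`, `h15T`, bookkeeping, structure) unchanged.

HONEST SCOPE.  (i) Dischargeability-NEUTRAL today: (J0ᵛ) is NODE 00's existence∕analyticity theory of the (2.12) minimisers at the lattice objects
([Balaban1985Variational] Thm 1, Sects. F–G), not typed in the tree; this module only moves the letter from the action's currency to the configuration's (print's (190)).
(ii) `SU(2)` only (the adjugate reading of `U⁻¹` and `Im tr = 0` are the `N = 2` facts).  (iii) §1–§2 are generic kernel facts, usable by the [LF-II] (1.10)–(1.11)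
rows that extend plaquette integrals analytically.  Count-neutral; NOT a discharge of N12; nothing continuum ∕ OS ∕ mass-gap ∕ Clay.  No `def` ∕ `instance` ∕ `sorry`.

## References
* [Balaban1989LargeFieldI] T. Bałaban, Commun. Math. Phys. 122 (1989) 175–202, (1.74) p. 192, (1.77) and Prop. 1 p. 194 (last clause).
* [Balaban1989LargeFieldII] T. Bałaban, Commun. Math. Phys. 122 (1989) 355–392, (1.7)–(1.11) p. 358, (1.12)–(1.13) p. 359.
* [Balaban1985Variational] T. Bałaban, Commun. Math. Phys. 102 (1985) 277–309, Prop. 9 and (190) p. 309.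
* [Balaban1988Convergent] CMP 119 (1988) 243–285, (2.12)–(2.14) pp. 256–257; [Balaban1987RG1] CMP 109 (1987) 249–301, (0.2) p. 252 (Wilson action).
-/

noncomputable section
open Set Metric
namespace Literature.MathematicalPhysics.QuantumFieldTheory.Balaban1983to89.B15Prop1JointHolomorphyFromBackground

open T4Continuum B15DeterminingSets GaugeField B15Prop1Carrier B8Eq17ClassAkV1 BlockAveraging
open B14.Eq22Determines (blockIter IsBlockUnion)
open Literature.MathematicalPhysics.QuantumFieldTheory.BalabanImbrieJaffe1984to88.BIJ85Eq453GaugeField (qsstarGIter0)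
open B15Prop1DatumSmall7AtZSequence B15Prop1Thm1GeneralFormAtZSequence B15Prop1Thm1GeneralFormShapes
open Literature.Computability.QuantumComplexity (star_coe_eq_adjugate trace_coe_im)
open Literature.MathematicalPhysics.QuantumLattice (fundamentalRep fundamentalRep_apply)
open T4CubeChartGnomonic (SU2)
open scoped BigOperators

/-! ## §1 `SU(2)`-valued gauge fields as complex matrices: the Wilson action is a trace polynomial -/

section SUTwo
variable {P : Params} {j : ℕ}

/-- In `SU(2)` the group inverse, read in `M₂(ℂ)`, is the ADJUGATE: `↑(U⁻¹) = U† = adj U` (`SU2ChordGeometry.star_coe_eq_adjugate`). [folklore] -/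
private theorem coe_inv_eq_adjugate (g : SU2) :
    ((g⁻¹ : SU2) : Matrix (Fin 2) (Fin 2) ℂ) = Matrix.adjugate (g : Matrix (Fin 2) (Fin 2) ℂ) := by
  rw [← star_coe_eq_adjugate]
  rfl

/-- Bałaban's normalised trace on `SU(2)` (`UnitaryModel`: `reTr = Re Tr ∕ N`) is `Re tr U ∕ 2`. [cite: Balaban1987RG1, (0.2) p.252] -/
theorem reTr_eq_trace_re (g : SU2) : reTr g = ((g : Matrix (Fin 2) (Fin 2) ℂ).trace).re / 2 := by
  show UnitaryModel.nReTr (fundamentalRep (Fin 2) g) = _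
  simp [UnitaryModel.nReTr, fundamentalRep_apply]

/-- One plaquette term of the Wilson action as a complex number: `1 − reTr U = 1 − tr U ∕ 2` (the trace of an `SU(2)` matrix is real,
`SU2ChordGeometry.trace_coe_im`). [cite: Balaban1987RG1, (0.2) p.252] -/
theorem ofReal_one_sub_reTr (g : SU2) :
    (((1 : ℝ) - reTr g : ℝ) : ℂ) = 1 - (g : Matrix (Fin 2) (Fin 2) ℂ).trace / 2 := by
  rw [reTr_eq_trace_re]
  have h : ((g : Matrix (Fin 2) (Fin 2) ℂ).trace) = ((((g : Matrix (Fin 2) (Fin 2) ℂ).trace).re : ℝ) : ℂ) := by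
    apply Complex.ext
    · simp
    · simp [trace_coe_im g]
  conv_rhs => rw [h]
  push_cast
  ring

/-- The plaquette variable `U(∂p) = U₁U₂U₃⁻¹U₄⁻¹` read in `M₂(ℂ)`: `U₁ · U₂ · adj U₃ · adj U₄`. [cite: Balaban1987RG1, (0.2) p.252] -/
theorem coe_plaqHol (U : GaugeField P j SU2) (p : Plaq P j) :
    ((plaqHol U p : SU2) : Matrix (Fin 2) (Fin 2) ℂ) =
      (U ⟨p.src, p.μ⟩ : Matrix (Fin 2) (Fin 2) ℂ) * (U ⟨p.src.shift p.μ, p.ν⟩ : Matrix (Fin 2) (Fin 2) ℂ) *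
        Matrix.adjugate (U ⟨p.src.shift p.ν, p.μ⟩ : Matrix (Fin 2) (Fin 2) ℂ) *
          Matrix.adjugate (U ⟨p.src, p.ν⟩ : Matrix (Fin 2) (Fin 2) ℂ) := by
  simp only [plaqHol, MulMemClass.coe_mul, coe_inv_eq_adjugate]

/-- ★ **THE WILSON ACTION OF AN `SU(2)` FIELD IS A TRACE POLYNOMIAL IN THE MATRIX ENTRIES**: `(A(U) : ℂ) = Σ_p (1 − tr(U₁U₂·adj U₃·adj U₄)∕2)` —
the reading under which [Balaban1989LargeFieldII] p. 358 extends plaquette expressions «analytically on Gᶜ-valued configurations U» («The expressions in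
the integral are analytic functions of U»). [cite: Balaban1989LargeFieldII, (1.10)–(1.11) p.358; Balaban1987RG1, (0.2) p.252] -/
theorem ofReal_wilsonAction4 (U : GaugeField P j SU2) :
    ((wilsonAction4 U : ℝ) : ℂ) =
      ∑ p : Plaq P j, (1 - ((U ⟨p.src, p.μ⟩ : Matrix (Fin 2) (Fin 2) ℂ) * (U ⟨p.src.shift p.μ, p.ν⟩ : Matrix (Fin 2) (Fin 2) ℂ) *
        Matrix.adjugate (U ⟨p.src.shift p.ν, p.μ⟩ : Matrix (Fin 2) (Fin 2) ℂ) *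
          Matrix.adjugate (U ⟨p.src, p.ν⟩ : Matrix (Fin 2) (Fin 2) ℂ)).trace / 2) := by
  simp only [wilsonAction4, wilsonAction, one_mul, Complex.ofReal_sum]
  refine Finset.sum_congr rfl fun p _ => ?_
  rw [ofReal_one_sub_reTr, coe_plaqHol]
end SUTwo

/-! ## §2 Entrywise holomorphy and bounds of the trace polynomial along a matrix-field family -/

section Entrywise
variable {E : Type*} [NormedAddCommGroup E] [NormedSpace ℂ E] {s : Set E}

/-- The four entries of the adjugate of a `2 × 2` matrix. [folklore] -/
private theorem adjugate_apply_fin_two (A : Matrix (Fin 2) (Fin 2) ℂ) :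
    Matrix.adjugate A 0 0 = A 1 1 ∧ Matrix.adjugate A 0 1 = -A 0 1 ∧ Matrix.adjugate A 1 0 = -A 1 0 ∧ Matrix.adjugate A 1 1 = A 0 0 := by
  rw [Matrix.adjugate_fin_two]
  simp

/-- Entries of a product of two matrix families with ℂ-differentiable entries are ℂ-differentiable. [folklore] -/
private theorem differentiableOn_mul_apply {M N : E → Matrix (Fin 2) (Fin 2) ℂ} (hM : ∀ a c, DifferentiableOn ℂ (fun z => M z a c) s)
    (hN : ∀ a c, DifferentiableOn ℂ (fun z => N z a c) s) (a c : Fin 2) : DifferentiableOn ℂ (fun z => (M z * N z) a c) s := by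
  have e : (fun z => (M z * N z) a c) = fun z => M z a 0 * N z 0 c + M z a 1 * N z 1 c := by
    funext z
    rw [Matrix.mul_apply, Fin.sum_univ_two]
  rw [e]
  exact ((hM a 0).mul (hN 0 c)).add ((hM a 1).mul (hN 1 c))

/-- Entries of the adjugate of a `2 × 2` matrix family with ℂ-differentiable entries are ℂ-differentiable. [folklore] -/
private theorem differentiableOn_adjugate_apply {M : E → Matrix (Fin 2) (Fin 2) ℂ} (hM : ∀ a c, DifferentiableOn ℂ (fun z => M z a c) s) (a c : Fin 2) :
    DifferentiableOn ℂ (fun z => Matrix.adjugate (M z) a c) s := by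
  fin_cases a <;> fin_cases c <;> simp only [Fin.zero_eta, Fin.mk_one, Fin.isValue]
  · exact (hM 1 1).congr fun z _ => (adjugate_apply_fin_two (M z)).1
  · exact (hM 0 1).neg.congr fun z _ => (adjugate_apply_fin_two (M z)).2.1
  · exact (hM 1 0).neg.congr fun z _ => (adjugate_apply_fin_two (M z)).2.2.1
  · exact (hM 0 0).congr fun z _ => (adjugate_apply_fin_two (M z)).2.2.2

/-- Entries of the plaquette product `M₁M₂·adj M₃·adj M₄` of four matrix families with ℂ-differentiable entries are ℂ-differentiable. [folklore] -/
private theorem differentiableOn_plaqProd_apply {M₁ M₂ M₃ M₄ : E → Matrix (Fin 2) (Fin 2) ℂ} (h₁ : ∀ a c, DifferentiableOn ℂ (fun z => M₁ z a c) s)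
    (h₂ : ∀ a c, DifferentiableOn ℂ (fun z => M₂ z a c) s) (h₃ : ∀ a c, DifferentiableOn ℂ (fun z => M₃ z a c) s)
    (h₄ : ∀ a c, DifferentiableOn ℂ (fun z => M₄ z a c) s) (a c : Fin 2) :
    DifferentiableOn ℂ (fun z => (M₁ z * M₂ z * Matrix.adjugate (M₃ z) * Matrix.adjugate (M₄ z)) a c) s :=
  differentiableOn_mul_apply (differentiableOn_mul_apply (differentiableOn_mul_apply h₁ h₂) (differentiableOn_adjugate_apply h₃))
    (differentiableOn_adjugate_apply h₄) a c

/-- ★ **HOLOMORPHY OF THE TRACE-POLYNOMIAL WILSON ACTION ALONG A MATRIX-FIELD FAMILY**: if every entry `z ↦ W z b a c` of a family of `M₂(ℂ)`-valued bond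
configurations is ℂ-differentiable on `s`, so is `z ↦ Σ_p (1 − tr(W₁W₂·adj W₃·adj W₄)∕2)` ([Balaban1989LargeFieldII] p. 358 «The expressions in the integral
are analytic functions of U»). [cite: Balaban1989LargeFieldII, (1.10)–(1.11) p.358] -/
theorem differentiableOn_actionSum {P : Params} {j : ℕ} {W : E → PBond P j → Matrix (Fin 2) (Fin 2) ℂ}
    (hW : ∀ b a c, DifferentiableOn ℂ (fun z => W z b a c) s) :
    DifferentiableOn ℂ (fun z => ∑ p : Plaq P j, (1 - (W z ⟨p.src, p.μ⟩ * W z ⟨p.src.shift p.μ, p.ν⟩ *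
        Matrix.adjugate (W z ⟨p.src.shift p.ν, p.μ⟩) * Matrix.adjugate (W z ⟨p.src, p.ν⟩)).trace / 2)) s := by
  refine DifferentiableOn.fun_sum fun p _ => ?_
  have hP := differentiableOn_plaqProd_apply (hW ⟨p.src, p.μ⟩) (hW ⟨p.src.shift p.μ, p.ν⟩) (hW ⟨p.src.shift p.ν, p.μ⟩) (hW ⟨p.src, p.ν⟩)
  have e : (fun z => (1 : ℂ) - (W z ⟨p.src, p.μ⟩ * W z ⟨p.src.shift p.μ, p.ν⟩ * Matrix.adjugate (W z ⟨p.src.shift p.ν, p.μ⟩) *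
      Matrix.adjugate (W z ⟨p.src, p.ν⟩)).trace / 2) =
      fun z => (1 : ℂ) - ((W z ⟨p.src, p.μ⟩ * W z ⟨p.src.shift p.μ, p.ν⟩ * Matrix.adjugate (W z ⟨p.src.shift p.ν, p.μ⟩) *
        Matrix.adjugate (W z ⟨p.src, p.ν⟩)) 0 0 + (W z ⟨p.src, p.μ⟩ * W z ⟨p.src.shift p.μ, p.ν⟩ * Matrix.adjugate (W z ⟨p.src.shift p.ν, p.μ⟩) *
        Matrix.adjugate (W z ⟨p.src, p.ν⟩)) 1 1) * (2 : ℂ)⁻¹ := by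
    funext z
    rw [Matrix.trace_fin_two, div_eq_mul_inv]
  rw [e]
  exact (differentiableOn_const _).sub (((hP 0 0).add (hP 1 1)).mul_const _)

/-- Entry bound for a product of two `2 × 2` matrices: `|(MN)_{ac}| ≤ 2xy`. [folklore] -/
private theorem norm_mul_apply_le {M N : Matrix (Fin 2) (Fin 2) ℂ} {x y : ℝ} (hM : ∀ a c, ‖M a c‖ ≤ x) (hN : ∀ a c, ‖N a c‖ ≤ y) (hx : 0 ≤ x)
    (a c : Fin 2) : ‖(M * N) a c‖ ≤ 2 * x * y := by
  rw [Matrix.mul_apply, Fin.sum_univ_two]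
  calc ‖M a 0 * N 0 c + M a 1 * N 1 c‖ ≤ ‖M a 0‖ * ‖N 0 c‖ + ‖M a 1‖ * ‖N 1 c‖ := by
        refine (norm_add_le _ _).trans ?_
        rw [norm_mul, norm_mul]
    _ ≤ x * y + x * y :=
        add_le_add (mul_le_mul (hM _ _) (hN _ _) (norm_nonneg _) hx) (mul_le_mul (hM _ _) (hN _ _) (norm_nonneg _) hx)
    _ = 2 * x * y := by ring

/-- Entry bound for the adjugate of a `2 × 2` matrix. [folklore] -/
private theorem norm_adjugate_apply_le {M : Matrix (Fin 2) (Fin 2) ℂ} {x : ℝ} (hM : ∀ a c, ‖M a c‖ ≤ x) (a c : Fin 2) : ‖Matrix.adjugate M a c‖ ≤ x := by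
  obtain ⟨h00, h01, h10, h11⟩ := adjugate_apply_fin_two M
  fin_cases a <;> fin_cases c
  · show ‖Matrix.adjugate M 0 0‖ ≤ x; rw [h00]; exact hM 1 1
  · show ‖Matrix.adjugate M 0 1‖ ≤ x; rw [h01, norm_neg]; exact hM 0 1
  · show ‖Matrix.adjugate M 1 0‖ ≤ x; rw [h10, norm_neg]; exact hM 1 0
  · show ‖Matrix.adjugate M 1 1‖ ≤ x; rw [h11]; exact hM 0 0

/-- Entry bound for the plaquette product: `|(M₁M₂·adj M₃·adj M₄)_{ac}| ≤ 8x⁴` when all entries are `≤ x`. [folklore] -/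
private theorem norm_plaqProd_apply_le {M₁ M₂ M₃ M₄ : Matrix (Fin 2) (Fin 2) ℂ} {x : ℝ} (hx : 0 ≤ x) (h₁ : ∀ a c, ‖M₁ a c‖ ≤ x) (h₂ : ∀ a c, ‖M₂ a c‖ ≤ x)
    (h₃ : ∀ a c, ‖M₃ a c‖ ≤ x) (h₄ : ∀ a c, ‖M₄ a c‖ ≤ x) (a c : Fin 2) :
    ‖(M₁ * M₂ * Matrix.adjugate M₃ * Matrix.adjugate M₄) a c‖ ≤ 8 * x ^ 4 := by
  have s₂ : ∀ a c, ‖(M₁ * M₂ * Matrix.adjugate M₃) a c‖ ≤ 2 * (2 * x * x) * x :=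
    norm_mul_apply_le (norm_mul_apply_le h₁ h₂ hx) (norm_adjugate_apply_le h₃) (by positivity)
  calc ‖(M₁ * M₂ * Matrix.adjugate M₃ * Matrix.adjugate M₄) a c‖ ≤ 2 * (2 * (2 * x * x) * x) * x :=
        norm_mul_apply_le s₂ (norm_adjugate_apply_le h₄) (by positivity) a c
    _ = 8 * x ^ 4 := by ring

/-- The plaquette term bound: `|1 − tr W ∕ 2| ≤ 1 + 8x⁴` when the entries of `W` are `≤ 8x⁴`. [folklore] -/
private theorem norm_one_sub_trace_div_two_le {W : Matrix (Fin 2) (Fin 2) ℂ} {x : ℝ} (hW : ∀ a c, ‖W a c‖ ≤ 8 * x ^ 4) :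
    ‖(1 : ℂ) - W.trace / 2‖ ≤ 1 + 8 * x ^ 4 := by
  rw [Matrix.trace_fin_two]
  have h2 : ‖(2 : ℂ)‖ = 2 := by simp
  calc ‖(1 : ℂ) - (W 0 0 + W 1 1) / 2‖ ≤ ‖(1 : ℂ)‖ + ‖(W 0 0 + W 1 1) / 2‖ := norm_sub_le _ _
    _ ≤ 1 + (8 * x ^ 4 + 8 * x ^ 4) / 2 := by
        rw [norm_one, norm_div, h2]
        exact add_le_add le_rfl (div_le_div_of_nonneg_right ((norm_add_le _ _).trans (add_le_add (hW 0 0) (hW 1 1))) zero_le_two)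
    _ = 1 + 8 * x ^ 4 := by ring

/-- ★ **THE BOUND OF THE TRACE-POLYNOMIAL WILSON ACTION**: entries `≤ 𝓐₀` ⇒ `|Σ_p (1 − tr(W₁W₂·adj W₃·adj W₄)∕2)| ≤ |Plaq| · (1 + 8𝓐₀⁴)`.
[cite: Balaban1989LargeFieldII, (1.11) p.358] -/
theorem norm_actionSum_le {P : Params} {j : ℕ} {W : PBond P j → Matrix (Fin 2) (Fin 2) ℂ} {x : ℝ} (hW : ∀ b a c, ‖W b a c‖ ≤ x) :
    ‖∑ p : Plaq P j, (1 - (W ⟨p.src, p.μ⟩ * W ⟨p.src.shift p.μ, p.ν⟩ * Matrix.adjugate (W ⟨p.src.shift p.ν, p.μ⟩) *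
        Matrix.adjugate (W ⟨p.src, p.ν⟩)).trace / 2)‖ ≤ (Fintype.card (Plaq P j) : ℝ) * (1 + 8 * x ^ 4) := by
  refine (norm_sum_le _ _).trans ?_
  have hterm : ∀ p : Plaq P j, ‖(1 : ℂ) - (W ⟨p.src, p.μ⟩ * W ⟨p.src.shift p.μ, p.ν⟩ * Matrix.adjugate (W ⟨p.src.shift p.ν, p.μ⟩) *
      Matrix.adjugate (W ⟨p.src, p.ν⟩)).trace / 2‖ ≤ 1 + 8 * x ^ 4 := fun p => by
    have hx : 0 ≤ x := (norm_nonneg _).trans (hW ⟨p.src, p.μ⟩ 0 0)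
    exact norm_one_sub_trace_div_two_le (norm_plaqProd_apply_le hx (hW _) (hW _) (hW _) (hW _))
  calc ∑ p : Plaq P j, ‖(1 : ℂ) - (W ⟨p.src, p.μ⟩ * W ⟨p.src.shift p.μ, p.ν⟩ * Matrix.adjugate (W ⟨p.src.shift p.ν, p.μ⟩) *
          Matrix.adjugate (W ⟨p.src, p.ν⟩)).trace / 2‖
        ≤ ∑ _p : Plaq P j, (1 + 8 * x ^ 4) := Finset.sum_le_sum fun p _ => hterm p
    _ = (Fintype.card (Plaq P j) : ℝ) * (1 + 8 * x ^ 4) := by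
        rw [Finset.sum_const, Finset.card_univ, nsmul_eq_mul]
end Entrywise

/-! ## §3 (J1) from (J0ᵛ): the joint holomorphic extension of the action from a value-matched holomorphic family of configurations -/

section JointFromBackground
open B15Sect1Instances B16Sect1Backgrounds
open B15Prop1AnalyticExtClause (cplxVec)
open B15Prop1ChartCalculusSU2 (E3)
open B15Prop1ChartSU2 (su2Chart)

/-- ★ **(J1) ⇐ (J0ᵛ) AT ONE DATUM** — [Balaban1989LargeFieldI] Prop. 1 p. 194, last clause, mechanism of [Balaban1989LargeFieldII] p. 359 («The above equations,
bounds and statements are valid for 𝔤ᶜ-valued fields, hence the existence of the analytic extension follows immediately»): if along the chart family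
`(p, B′) ↦ exp(iB′)·ext(exp(ip)V_k)` there is ONE family `Ũ` on the sup-ball of radius `R`, bondwise in `M₂(ℂ)`, with ℂ-differentiable entries bounded by `𝓐₀`,
which at every REAL point IS some `SU(2)` configuration `U′` carrying the VALUE of print's function (1.77) (`wilsonAction4 U′ = fun177std … = A(U_{k,Z}(·))`) —
the VALUE-MATCHED reading (J0ᵛ): inhabited by ANY holomorphic family of (2.12) minimisers ([Balaban1985Variational] Prop. 9 ∕ (190): (1.77) is the value function,
so every minimiser of the datum has the value), and deliberately NOT pinned to the opaque selector `UminOfRecord` behind `bgKZstd` at the record (n12-w1's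
LOCATED-SELECTOR) — then (1.77) is the real trace of the ℂ-differentiable `𝒢 := Σ_p (1 − tr(Ũ₁Ũ₂·adj Ũ₃·adj Ũ₄)∕2)`, bounded by `|Plaq| · (1 + 8𝓐₀⁴)`: the letter
(J1) `hGj` of the N12∕s1 endpoints, with an explicit `𝓐`.
[cite: Balaban1989LargeFieldI, (1.74) p.192, (1.77) and Prop. 1 p.194; Balaban1989LargeFieldII, p.358, p.359; Balaban1985Variational, Prop. 9 (190) p.309] -/
theorem jointHolomorphic_fun177std_of_valueMatched {P : Params} {av : ∀ j, Averaging P j SU2} (bg : DetBackground P SU2 av) (M₁ : ℕ) (Z : Set (Site P 0)) (k : ℕ)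
    (ext : GaugeField P k SU2 → GaugeField P k SU2) (Vk : GaugeField P k SU2) {R 𝓐₀ : ℝ}
    (hBg : ∃ Ũ : VecField P k (EuclideanSpace ℂ (Fin 3)) × VecField P k (EuclideanSpace ℂ (Fin 3)) → PBond P 0 → Matrix (Fin 2) (Fin 2) ℂ,
      (∀ b a c, DifferentiableOn ℂ (fun z => Ũ z b a c) (ball 0 R)) ∧
      (∀ z ∈ ball (0 : VecField P k (EuclideanSpace ℂ (Fin 3)) × VecField P k (EuclideanSpace ℂ (Fin 3))) R, ∀ b a c, ‖Ũ z b a c‖ ≤ 𝓐₀) ∧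
      ∀ p B' : VecField P k E3, ‖p‖ < R → ‖B'‖ < R → ∃ U' : GaugeField P 0 SU2,
        (∀ b, Ũ (cplxVec p, cplxVec B') b = ((U' b : SU2) : Matrix (Fin 2) (Fin 2) ℂ)) ∧
          wilsonAction4 U' = fun177std bg M₁ Z k (expMul su2Chart B' (ext (expMul su2Chart p Vk)))) :
    ∃ 𝒢 : VecField P k (EuclideanSpace ℂ (Fin 3)) × VecField P k (EuclideanSpace ℂ (Fin 3)) → ℂ,
      DifferentiableOn ℂ 𝒢 (ball 0 R) ∧
      (∀ z ∈ ball (0 : VecField P k (EuclideanSpace ℂ (Fin 3)) × VecField P k (EuclideanSpace ℂ (Fin 3))) R,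
        ‖𝒢 z‖ ≤ (Fintype.card (Plaq P 0) : ℝ) * (1 + 8 * 𝓐₀ ^ 4)) ∧
      ∀ p B' : VecField P k E3, ‖p‖ < R → ‖B'‖ < R →
        𝒢 (cplxVec p, cplxVec B') = ((fun177std bg M₁ Z k (expMul su2Chart B' (ext (expMul su2Chart p Vk))) : ℝ) : ℂ) := by
  obtain ⟨Ũ, hdiff, hbd, hreal⟩ := hBg
  refine ⟨fun z => ∑ q : Plaq P 0, (1 - (Ũ z ⟨q.src, q.μ⟩ * Ũ z ⟨q.src.shift q.μ, q.ν⟩ * Matrix.adjugate (Ũ z ⟨q.src.shift q.ν, q.μ⟩) *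
      Matrix.adjugate (Ũ z ⟨q.src, q.ν⟩)).trace / 2), differentiableOn_actionSum hdiff, fun z hz => norm_actionSum_le (hbd z hz), ?_⟩
  intro p B' hp hB'
  obtain ⟨U', hU', hval⟩ := hreal p B' hp hB'
  rw [← hval, ofReal_wilsonAction4]
  refine Finset.sum_congr rfl fun q _ => ?_
  simp only [hU']
end JointFromBackground

/-! ## §4 Proposition 1 [IV] at print's (1.74) object with the value-matched configuration letter (J0ᵛ) in place of (J1) -/

section Endpoint
open Classical
open scoped RealInnerProductSpace InnerProductSpace
open B14DomainGeom (IsUnionOfCubes)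
open B15Eq112TorusCover (cover)
open B14.Eq213MaximalDomains (side)
open B14.Eq213DetSet B15Sect1Instances B16Sect1Wilson B16Sect1Backgrounds B15Prop1GradientFromNearValue B15Prop1GradientFromNearValueAtCoPRecord
open B15Prop1AtZSequenceRecord B15Prop1SliceTaylorCalculus B15Prop1IntrinsicOfFun
open B15Prop1AnalyticExtClause (cplxVec cplxSlice anExt)
open B15Prop1ChartCalculusSU2 (E3)
open B15Prop1ChartSU2 (su2Chart)
open B15Prop1SliceCoordinates (GaugeSlice ιA freeBonds)
open T4AxialGaugeSmallField (castSite boxPlaqs)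
open B6BondElimination (unitVec)
open B16Eq18Proof (box)
open B15Extension193 (extend)
open B15ShellGauge193 (shellGauge)
open B5Bounds167Lattice (formDk ofRealCfg)
open T4Continuum

/-- ★★★ **PROPOSITION 1 [IV] AT PRINT'S (1.74) OBJECT, THE ANALYTIC INPUT IN PRINT'S (190) CURRENCY** —
`B15Prop1Thm1GeneralFormShapes.exists_domain_prop1Printed_lfVarOn_std_su2_box_intrinsic_analytic_atZSeqCoPRecord_ofThm1TorusClass` (p556967) VERBATIM but for
the joint-holomorphy letter: (J1) `hGj` (ONE ℂ-differentiable bounded extension of the ACTION `(p, B′) ↦ A(U_{k,Z}(exp(iB′)·ext(exp(ip)V_k)))`) is REPLACED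
by (J0ᵛ) `hBg` — ONE family of CONFIGURATIONS, bondwise in `M₂(ℂ)` with ℂ-differentiable entries bounded by `𝓐₀ i`, which at every real point of the ball IS
an `SU(2)` configuration carrying the value (1.77) ([Balaban1985Variational] Prop. 9 p. 309: «The minimal configuration U_k(V) … has an extension to an analytic
function of Gᶜ-valued small configurations V′» — any such family of (2.12) minimisers of the data inhabits (J0ᵛ), (1.77) being the value function; the letter is
NOT pinned to the `Classical.choose` selector `UminOfRecord` of NODE 00's `bgMSCoPOfRecord`, n12-w1's LOCATED-SELECTOR) — and the action bound becomes the
explicit `𝓐 i := |Plaq (F.P Kt) 0| · (1 + 8(𝓐₀ i)⁴)` (§3) in `hcJ'` and in the clause's radius; `h𝓐` disappears.  Every other binder and the conclusion as in p556967.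
[cite: Balaban1989LargeFieldI, (1.74) p.192, Prop. 1 (1.77)–(1.78) p.194 (incl. the last clause), p.193, (1.79) p.195; Balaban1989LargeFieldII, (1.7)–(1.9)
p.358, (1.12)–(1.13) p.359; Balaban1985Variational, (1) p.277, Thm 1 (8) p.279, Prop. 9 (190) p.309; Balaban1988Convergent, (2.12)–(2.14) pp.256–257,
(2.16)–(2.18) p.257] -/
theorem exists_domain_prop1Printed_lfVarOn_std_su2_box_intrinsic_analytic_atZSeqCoPRecord_ofThm1TorusClass_ofValueMatched {F : T4Family}
    (ν : Node00.Stage7Numerics) (Kt : ℕ) (hd3 : 3 ≤ (F.P Kt).d) (h0 : 0 < (F.P Kt).d) {ι : Type}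
    [hdec : ∀ j, DecidableEq (PBond (F.P Kt) j)] (hcl : hdec = fun _ a b => Classical.propDecidable (a = b))
    (Z Λ : ι → Set (Site (F.P Kt) 0)) (k : ι → ℕ) (M : ι → ℝ) (hk0 : ∀ i, 0 < k i) (hk : ∀ i, k i ≤ (F.P Kt).m + (F.P Kt).K)
    (eR : ι → ℝ) (heR : ∀ i, 0 < eR i)
    (T : ∀ i, Finset (PBond (F.P Kt) (k i)))
    (lo hi : ι → Fin (F.P Kt).d → ℤ) (n : ι → ℕ) (hn : ∀ i κ, hi i κ ≤ lo i κ + n i) (hN : ∀ i, n i + 2 < (F.P Kt).sitesPerDir (k i))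
    (hbox : ∀ i, pts (k i) (Λ i) = (castSite '' Set.Icc (lo i) (hi i) : Set (Site (F.P Kt) (k i))))
    (hZ : ∀ i, (boxPlaqs (lo i - 1) (hi i + 1) : Set (Plaq (F.P Kt) (k i))) ⊆ plaqsInside (pts (k i) (Z i)))
    (hTG0 : ∀ i, T i = (box (fun κ => (hi i κ - lo i κ + 1).toNat) (lo i)).image fun x =>
      (⟨castSite (x - unitVec ⟨0, h0⟩), ⟨0, h0⟩⟩ : PBond (F.P Kt) (k i)))
    (hN5 : ∀ i κ, ((hi i κ - lo i κ + 1).toNat : ℤ) + 5 < (F.P Kt).sitesPerDir (k i))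
    (K : ι → ℕ) (hK1 : ∀ i, 1 ≤ K i) (hKn : ∀ i κ, (hi i κ - lo i κ + 1).toNat ≤ K i)
    (ext : ∀ i, GaugeField (F.P Kt) (k i) SU2 → GaugeField (F.P Kt) (k i) SU2)
    (hext : ∀ i Vk, ext i Vk = extend (pts (k i) (Λ i)) (shellGauge Vk (lo i) (hi i)) Vk)
    (hlohi : ∀ i, lo i ≤ hi i)
    {γ cJ bx : ℝ} (hγ : 0 < γ) (hcJ : 0 ≤ cJ) (hbx : 0 ≤ bx)
    (hbxM : ∀ i, 12 * ((F.P Kt).d : ℝ) * ((n i : ℝ) + 2) ^ 2 ≤ bx * (M i) ^ 2)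
    {Cerr R 𝓐₀ : ι → ℝ} (hM : ∀ i, 1 ≤ (M i)) (hR : ∀ i, 0 < R i)
    (n' : ι → ℕ) (hn' : ∀ i, 1 ≤ n' i)
    -- (J0ᵛ) ONE family along the chart family with ℂ-differentiable bounded matrix entries which at every real point IS an `SU(2)` configuration carrying
    -- the VALUE (1.77) — print's (190) currency (any holomorphic family of (2.12) minimisers inhabits it); not pinned to the selector `UminOfRecord`
    (hBg : ∀ i Vk, PlaqSmallOn (plaqsInside (pts (k i) (Z i ∩ (Λ i)ᶜ))) (eR i) Vk →
      ∃ Ũ : VecField (F.P Kt) (k i) (EuclideanSpace ℂ (Fin 3)) × VecField (F.P Kt) (k i) (EuclideanSpace ℂ (Fin 3)) →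
          PBond (F.P Kt) 0 → Matrix (Fin 2) (Fin 2) ℂ,
        (∀ b a c, DifferentiableOn ℂ (fun z => Ũ z b a c) (ball 0 (R i))) ∧
        (∀ z ∈ ball (0 : VecField (F.P Kt) (k i) (EuclideanSpace ℂ (Fin 3)) × VecField (F.P Kt) (k i) (EuclideanSpace ℂ (Fin 3))) (R i),
          ∀ b a c, ‖Ũ z b a c‖ ≤ 𝓐₀ i) ∧
        ∀ p B' : VecField (F.P Kt) (k i) E3, ‖p‖ < R i → ‖B'‖ < R i → ∃ U' : GaugeField (F.P Kt) 0 SU2,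
          (∀ b, Ũ (cplxVec p, cplxVec B') b = ((U' b : SU2) : Matrix (Fin 2) (Fin 2) ℂ)) ∧
            wilsonAction4 U' =
              fun177std (Node00.bgMSCoPOfRecord F 2 ν Kt (k i) (maxDomT ν.M₁ (Z i))) ν.M₁ (Z i) (k i)
                (expMul su2Chart B' (ext i (expMul su2Chart p Vk))))
    -- (L2) (1.7)–(1.9) p.358 for the Hessian of the slice function at `0`
    (hlead : ∀ i Vk, PlaqSmallOn (plaqsInside (pts (k i) (Z i ∩ (Λ i)ᶜ))) (eR i) Vk →
      ∀ X : GaugeSlice (pts (k i) (Λ i)) (T i) E3,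
      |⟪X, (fderiv ℝ (rGrad (pts (k i) (Λ i)) (T i)
              (sliceFn (pts (k i) (Λ i)) (T i)
                (fun177std (Node00.bgMSCoPOfRecord F 2 ν Kt (k i) (maxDomT ν.M₁ (Z i))) ν.M₁ (Z i) (k i)) (ext i Vk))) 0) X⟫ -
          ∑ a : Fin 3, formDk (n' i) (fun _ : Fin (F.P Kt).d => (F.P Kt).sitesPerDir (k i))
            (ofRealCfg (fun _ : Fin (F.P Kt).d => (F.P Kt).sitesPerDir (k i)) fun j =>
              ιA (pts (k i) (Λ i)) (T i) X ⟨j.1, j.2⟩ a)| ≤ Cerr i * ‖X‖ ^ 2)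
    (hsm : ∀ i, Cerr i ≤ (4 / Real.pi ^ 2) ^ ((F.P Kt).d + 2) / (2 * (3 * (K i : ℝ) ^ 2 + 2 * (K i : ℝ) ^ 4)))
    (hγle : ∀ i, γ / (M i) ^ 5 ≤ (4 / Real.pi ^ 2) ^ ((F.P Kt).d + 2) / (2 * (3 * (K i : ℝ) ^ 2 + 2 * (K i : ℝ) ^ 4)))
    -- the geometric letter: the k-blocks over the bonds meeting `Λ^{(k)}` lie inside `Ω₁(Z)`
    (hfar : ∀ i (b : PBond (F.P Kt) 0), b.src ∉ maxDomT ν.M₁ (Z i) 1 →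
      (⟨blockIter (k i) b.src, b.dir⟩ : PBond (F.P Kt) (k i)) ∉ bondsOf (pts (k i) (Λ i)))
    -- (Gᵃ) geometry of `Z`: a union of `k`-blocks
    (hZblk : ∀ i, IsBlockUnion (k i) (Z i))
    -- print's `M₁ ≥ 2` and the torus divisibility `L^{k}M₁ ∣ 2L^{m+K}`
    (hM2 : 2 ≤ ν.M₁) (hdiv : ∀ i, side (F.P Kt).L ν.M₁ (k i) ∣ (F.P Kt).sitesPerDir 0)
    -- bookkeeping constants
    {cE B₃ a₀ a₁' cA : ℝ} (hcE0 : 0 ≤ cE) (hcE : ∀ i, 12 * ((F.P Kt).d : ℝ) * ((n i : ℝ) + 2) ^ 2 ≤ cE) (hB₃ : 0 ≤ B₃)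
    (heRa : ∀ i, (cE + 1) * eR i ≤ a₁' ∧ B₃ * ((cE + 1) * eR i) ≤ ν.εreg) (ha₀ : ν.εreg ≤ a₀)
    (hcA : 1 / 2 * (B₃ * (cE + 1) * (F.P Kt).eta 1 ^ 2) ^ 2 * (Fintype.card (Plaq (F.P Kt) 0) : ℝ) ≤ cA)
    -- [15] THEOREM 1 (R), CLOSED GENERAL-SEQUENCE FORM, GUARDED, IN NODE 00's TORUS-NATIVE CLASS (shape (C)) — served by K0⁷'s def (n12-d 12Q⁵)
    (h15T : ∀ (k' : ℕ), k' ≤ (F.P Kt).m + (F.P Kt).K → side (F.P Kt).L ν.M₁ k' ∣ (F.P Kt).sitesPerDir 0 →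
      ∀ (s : B14.Eq218Concrete.Seq (fun n : ℕ => Node00.unionsOfCubes (F.P Kt) (side (F.P Kt).L ν.M₁ n)) k'),
      Node00.Sect2.SeqSeparated ν.M₁ s → 0 < ν.M₁ →
      ∀ (ε₀ : ℝ) (δ : ℕ → ℝ), (∀ j, j ≤ k' → 0 < δ j ∧ δ j ≤ a₁' ∧ B₃ * δ j ≤ ε₀) → (∀ j, j < k' → δ j ≤ 2 * δ (j + 1)) →
      (∀ j, j < k' → δ (j + 1) ≤ 2 * δ j) → ε₀ ≤ a₀ →
      ∀ W : MSField (F.P Kt) SU2,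
        Node00.Sect2.DataSmall7PTop (Node00.avOfRecord F 2 Kt) s.Ω (Node00.suppDomOfRecord F ν Kt s.Ω) k' δ W →
        ∀ U₀ : GaugeField (F.P Kt) 0 SU2, IsMinimizer (Node00.avOfRecord F 2 Kt)
            {U | (∀ j, j ≤ k' → PlaqSmallOn (Node00.Sect2.omegaPlaqsTop s.Ω (Node00.suppDomOfRecord F ν Kt s.Ω) j)
                (ε₀ * (F.P Kt).eta j ^ 2) U) ∧
              Node00.Sect2.CoDivClassOnTop s.Ω (Node00.suppDomOfRecord F ν Kt s.Ω) k' ε₀ U}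
            (genSet s.Ω k') W U₀ →
          (∀ j, j ≤ k' → PlaqSmallOn (Node00.Sect2.omegaPlaqsTop s.Ω (Node00.suppDomOfRecord F ν Kt s.Ω) j)
              (B₃ * δ j * (F.P Kt).eta j ^ 2) U₀) ∧
            ∀ j, j ≤ k' → Node00.Sect2.CoDivSmallOn (Node00.Sect2.omegaBondsTop s.Ω (Node00.suppDomOfRecord F ν Kt s.Ω) j)
              (B₃ * δ j * (F.P Kt).eta j ^ 3) U₀)
    (hcJ' : ∀ i, 2 * cA * eR i / R i + 4 * ((Fintype.card (Plaq (F.P Kt) 0) : ℝ) * (1 + 8 * 𝓐₀ i ^ 4)) / (R i * eR i) ≤ cJ)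
    : ∃ a₁ : ι → ℝ, (∀ i, 0 < a₁ i) ∧
      B15.Prop1Printed (lfVarOn su2Chart fun i =>
        InstOn.std (Node00.bgMSCoPOfRecord F 2 ν Kt (k i) (maxDomT ν.M₁ (Z i))) ν.M₁ (Z i) (Λ i) (k i) (M i) (a₁ i)
          (anExt (pts (k i) (Λ i)) (T i)
            (fun177std (Node00.bgMSCoPOfRecord F 2 ν Kt (k i) (maxDomT ν.M₁ (Z i))) ν.M₁ (Z i) (k i)) (ext i)
            (min (1 / 2) (min (R i / 8) (γ / (M i) ^ 5 * (R i / 2) ^ 2 /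
              (48 * (4 * ((Fintype.card (Plaq (F.P Kt) 0) : ℝ) * (1 + 8 * 𝓐₀ i ^ 4)) / R i + 1))))))) :=
  exists_domain_prop1Printed_lfVarOn_std_su2_box_intrinsic_analytic_atZSeqCoPRecord_ofThm1TorusClass ν Kt hd3 h0 hcl Z Λ k M hk0 hk eR heR
    T lo hi n hn hN hbox hZ hTG0 hN5 K hK1 hKn ext hext hlohi hγ hcJ hbx hbxM (𝓐 := fun i => (Fintype.card (Plaq (F.P Kt) 0) : ℝ) * (1 + 8 * 𝓐₀ i ^ 4))
    hM hR (fun i => by positivity) n' hn'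
    (fun i Vk hV => jointHolomorphic_fun177std_of_valueMatched _ _ _ _ _ _ (hBg i Vk hV)) hlead hsm hγle hfar hZblk hM2 hdiv hcE0 hcE hB₃
    heRa ha₀ hcA h15T hcJ'
end Endpoint

/-! ## §5 (v1.1, lane owner dag-n12-c g22) The NEAR action along a matrix-field family: holomorphy and the bound `#S · (1 + 8𝓐₀⁴)` over a finite plaquette set `S`

Census axis U3 of the lane memo `N12-UNIFORMITY-SPEC.md` §4: §3's (J1) letter bounds the holomorphic extension of the TOTAL action by `|Plaq|·(1+8𝓐₀⁴)` — the torus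
plaquette count, which then sits in `cA`∕`cJ′`∕the analyticity radius of every endpoint downstream.  Print compares actions on the window only ([Balaban1989LargeFieldI] (1.77);
[Balaban1989LargeFieldII] (1.2)–(1.6) p.357).  The gradient road of `B15Prop1GradientFromNearValue` reads the gradient of the NEAR value `h` (the action over the near
plaquettes) through ANY bounded holomorphic extension of `h`; THIS SECTION supplies the natural one — the trace polynomial summed over a finite plaquette set `S` only —
with the bound `#S·(1+8𝓐₀⁴)`, so that a successor edition of the gradient road can take `𝓐 := #S·(1+8𝓐₀⁴)` with `S` the near plaquettes instead of `|Plaq|·(1+8𝓐₀⁴)`.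
Nothing landed is modified (append-only). -/

section NearAction
variable {E : Type*} [NormedAddCommGroup E] [NormedSpace ℂ E] {s : Set E}

/-- ★ **HOLOMORPHY OF THE TRACE-POLYNOMIAL ACTION OVER A FINITE PLAQUETTE SET** (`S`-restricted twin of `differentiableOn_actionSum`).
[cite: Balaban1989LargeFieldII, (1.10)–(1.11) p.358] -/
theorem differentiableOn_actionSumOn {P : Params} {j : ℕ} (S : Finset (Plaq P j)) {W : E → PBond P j → Matrix (Fin 2) (Fin 2) ℂ}
    (hW : ∀ b a c, DifferentiableOn ℂ (fun z => W z b a c) s) :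
    DifferentiableOn ℂ (fun z => ∑ p ∈ S, (1 - (W z ⟨p.src, p.μ⟩ * W z ⟨p.src.shift p.μ, p.ν⟩ *
        Matrix.adjugate (W z ⟨p.src.shift p.ν, p.μ⟩) * Matrix.adjugate (W z ⟨p.src, p.ν⟩)).trace / 2)) s := by
  refine DifferentiableOn.fun_sum fun p _ => ?_
  have hP := differentiableOn_plaqProd_apply (hW ⟨p.src, p.μ⟩) (hW ⟨p.src.shift p.μ, p.ν⟩) (hW ⟨p.src.shift p.ν, p.μ⟩) (hW ⟨p.src, p.ν⟩)
  have e : (fun z => (1 : ℂ) - (W z ⟨p.src, p.μ⟩ * W z ⟨p.src.shift p.μ, p.ν⟩ * Matrix.adjugate (W z ⟨p.src.shift p.ν, p.μ⟩) *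
      Matrix.adjugate (W z ⟨p.src, p.ν⟩)).trace / 2) =
      fun z => (1 : ℂ) - ((W z ⟨p.src, p.μ⟩ * W z ⟨p.src.shift p.μ, p.ν⟩ * Matrix.adjugate (W z ⟨p.src.shift p.ν, p.μ⟩) *
        Matrix.adjugate (W z ⟨p.src, p.ν⟩)) 0 0 + (W z ⟨p.src, p.μ⟩ * W z ⟨p.src.shift p.μ, p.ν⟩ * Matrix.adjugate (W z ⟨p.src.shift p.ν, p.μ⟩) *
        Matrix.adjugate (W z ⟨p.src, p.ν⟩)) 1 1) * (2 : ℂ)⁻¹ := by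
    funext z
    rw [Matrix.trace_fin_two, div_eq_mul_inv]
  rw [e]
  exact (differentiableOn_const _).sub (((hP 0 0).add (hP 1 1)).mul_const _)

/-- ★ **THE BOUND OF THE TRACE-POLYNOMIAL ACTION OVER A FINITE PLAQUETTE SET**: entries `≤ 𝓐₀` ⇒ `|Σ_{p ∈ S} (1 − tr(W₁W₂·adj W₃·adj W₄)∕2)| ≤ #S · (1 + 8𝓐₀⁴)`
(`S`-restricted twin of `norm_actionSum_le`: the count is the NEAR plaquette set's, not the torus's). [cite: Balaban1989LargeFieldII, (1.11) p.358, (1.6) p.357] -/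
theorem norm_actionSumOn_le {P : Params} {j : ℕ} (S : Finset (Plaq P j)) {W : PBond P j → Matrix (Fin 2) (Fin 2) ℂ} {x : ℝ} (hx : 0 ≤ x)
    (hW : ∀ b a c, ‖W b a c‖ ≤ x) :
    ‖∑ p ∈ S, (1 - (W ⟨p.src, p.μ⟩ * W ⟨p.src.shift p.μ, p.ν⟩ * Matrix.adjugate (W ⟨p.src.shift p.ν, p.μ⟩) *
        Matrix.adjugate (W ⟨p.src, p.ν⟩)).trace / 2)‖ ≤ (S.card : ℝ) * (1 + 8 * x ^ 4) := by
  refine (norm_sum_le _ _).trans ?_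
  have hterm : ∀ p : Plaq P j, ‖(1 : ℂ) - (W ⟨p.src, p.μ⟩ * W ⟨p.src.shift p.μ, p.ν⟩ * Matrix.adjugate (W ⟨p.src.shift p.ν, p.μ⟩) *
      Matrix.adjugate (W ⟨p.src, p.ν⟩)).trace / 2‖ ≤ 1 + 8 * x ^ 4 := fun p =>
    norm_one_sub_trace_div_two_le (norm_plaqProd_apply_le hx (hW _) (hW _) (hW _) (hW _))
  calc ∑ p ∈ S, ‖(1 : ℂ) - (W ⟨p.src, p.μ⟩ * W ⟨p.src.shift p.μ, p.ν⟩ * Matrix.adjugate (W ⟨p.src.shift p.ν, p.μ⟩) *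
          Matrix.adjugate (W ⟨p.src, p.ν⟩)).trace / 2‖
        ≤ ∑ _p ∈ S, (1 + 8 * x ^ 4) := Finset.sum_le_sum fun p _ => hterm p
    _ = (S.card : ℝ) * (1 + 8 * x ^ 4) := by rw [Finset.sum_const, nsmul_eq_mul]

end NearAction

section JointNear
open B15Sect1Instances B16Sect1Backgrounds
open B15Prop1AnalyticExtClause (cplxVec)
open B15Prop1ChartCalculusSU2 (E3)
open B15Prop1ChartSU2 (su2Chart)

/-- ★★ **THE NEAR ACTION IS JOINTLY HOLOMORPHIC WITH THE NEAR COUNT** — from the same configuration letter (J0ᵛ) as §3 (one bondwise `M₂(ℂ)` family `Ũ` on the sup-ball of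
radius `R` with ℂ-differentiable entries bounded by `𝓐₀`; its real-point clause is not even needed here), for ANY finite plaquette set `S`:
`𝒢_S := Σ_{p ∈ S} (1 − tr(Ũ₁Ũ₂·adj Ũ₃·adj Ũ₄)∕2)` is ℂ-differentiable on the ball, bounded by `#S·(1 + 8𝓐₀⁴)`, and wherever the family IS an `SU(2)` configuration `U′`
(at the real points, by (J0ᵛ)'s third clause) it equals the NEAR action `Σ_{p ∈ S} (1 − reTr U′(∂p))` of `U′` (cast to `ℂ`).  With `S` = the near plaquettes of the direct road (those meeting `Ω₁(Z)`) this is a bounded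
holomorphic extension of the near value `h` of `B15Prop1GradientFromNearValue` whose bound carries the near count only (census U3); the value-matching clause of (J0ᵛ) is
not needed for it and is therefore not asked.
[cite: Balaban1989LargeFieldI, (1.77) and Prop. 1 p.194; Balaban1989LargeFieldII, (1.2)–(1.6) p.357, p.358, p.359; Balaban1985Variational, Prop. 9 (190) p.309] -/
theorem jointHolomorphic_nearAction_of_cfgFamily {P : Params} {k : ℕ} (S : Finset (Plaq P 0)) {R 𝓐₀ : ℝ} (h𝓐₀ : 0 ≤ 𝓐₀)
    {Ũ : VecField P k (EuclideanSpace ℂ (Fin 3)) × VecField P k (EuclideanSpace ℂ (Fin 3)) → PBond P 0 → Matrix (Fin 2) (Fin 2) ℂ}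
    (hdiff : ∀ b a c, DifferentiableOn ℂ (fun z => Ũ z b a c) (ball 0 R))
    (hbd : ∀ z ∈ ball (0 : VecField P k (EuclideanSpace ℂ (Fin 3)) × VecField P k (EuclideanSpace ℂ (Fin 3))) R, ∀ b a c, ‖Ũ z b a c‖ ≤ 𝓐₀) :
    ∃ 𝒢 : VecField P k (EuclideanSpace ℂ (Fin 3)) × VecField P k (EuclideanSpace ℂ (Fin 3)) → ℂ,
      DifferentiableOn ℂ 𝒢 (ball 0 R) ∧
      (∀ z ∈ ball (0 : VecField P k (EuclideanSpace ℂ (Fin 3)) × VecField P k (EuclideanSpace ℂ (Fin 3))) R, ‖𝒢 z‖ ≤ (S.card : ℝ) * (1 + 8 * 𝓐₀ ^ 4)) ∧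
      ∀ p B' : VecField P k E3, ‖p‖ < R → ‖B'‖ < R → ∀ U' : GaugeField P 0 SU2,
        (∀ b, Ũ (cplxVec p, cplxVec B') b = ((U' b : SU2) : Matrix (Fin 2) (Fin 2) ℂ)) →
        𝒢 (cplxVec p, cplxVec B') = ∑ q ∈ S, ((((1 : ℝ) - reTr (plaqHol U' q) : ℝ)) : ℂ) := by
  refine ⟨fun z => ∑ q ∈ S, (1 - (Ũ z ⟨q.src, q.μ⟩ * Ũ z ⟨q.src.shift q.μ, q.ν⟩ * Matrix.adjugate (Ũ z ⟨q.src.shift q.ν, q.μ⟩) *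
      Matrix.adjugate (Ũ z ⟨q.src, q.ν⟩)).trace / 2), differentiableOn_actionSumOn S hdiff, fun z hz => norm_actionSumOn_le S h𝓐₀ (hbd z hz), ?_⟩
  intro p B' _ _ U' hU'
  refine Finset.sum_congr rfl fun q _ => ?_
  rw [ofReal_one_sub_reTr, coe_plaqHol]
  simp only [hU']

end JointNear

end Literature.MathematicalPhysics.QuantumFieldTheory.Balaban1983to89.B15Prop1JointHolomorphyFromBackground
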